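import Mathlib
import Summits.ResolutionOfSingularities.ResolutionOfSingularities.Theorems.RadicialJungCleanResolvesRegularType

/-!
# Route `RadicialJung`, crux `CleanModelsSuffice`: structure of the Kummer order

Let `A` be a regular local ring with fraction field `K` of characteristic `p`, `L/K` a field
extension of degree `p`, and `y ∈ L ∖ K` with `y^p = ∏_{i ≤ m} t_i^{a_i}` (`t_i ∈ A ∖ 0`,
`a₀ = 1`, `1 ≤ a_i < p`). The KUMMER ORDER is the `A`-subalgebra `R ⊆ L` generated by
`z_j = y^j / ∏_i t_i^{⌊j a_i / p⌋}` (`j < p`). This file proves its structure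
(`stub_kummerOrderStructure`):

1. `R` is the `A`-span of the `z_j`: `z_j z_k = (∏ t_i^{e_i}) · z_{(j+k) mod p}` with
   `e_i = ⌊(j+k)a_i/p⌋ - ⌊j a_i/p⌋ - ⌊k a_i/p⌋ ≥ 0` (using `y^p = ∏ t^a` when `j + k ≥ p`), and
   `z_0 = 1`;
2. the `z_j` are `A`-linearly independent (`1, y, …, y^{p-1}` are `K`-independent because the
   minimal polynomial of `y` is `T^p - ∏ t^a`, and `z_j` is a non-zero `K`-multiple of `y^j`);
3. hence `R` is module-finite over `A`;
4. `R` is local: `L` has characteristic `p` and `z_j^p = ∏ t_i^{(j a_i) mod p} ∈ A`, so by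
   Frobenius `r^p ∈ A` for every `r ∈ R`; for a maximal ideal `M ⊂ R` one has `M ∩ A = 𝔪_A`
   (integrality), whence `r ∈ M ⟺ r^p ∈ 𝔪_A`, a condition independent of `M`;
5. `Frac R = L`: `y = z_1 ∈ R` and every element of `L` is `q(y)/b` with `q ∈ A[T]`, `b ∈ A ∖ 0`
   (`exists_aeval_div_eq`).
-/

noncomputable section

set_option linter.dupNamespace false -- mandated namespace of this single-conjunct summit

open Polynomial

namespace Summit.ResolutionOfSingularities.ResolutionOfSingularities.Theorems.RadicialJung.CleanModelsSuffice

open Summit.ResolutionOfSingularities.ResolutionOfSingularities.Theorems.RadicialJung.CleanResolves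

/-- Floor arithmetic behind the multiplication table of the Kummer order: writing
`j + k = p q + l` (`q = (j+k)/p`, `l = (j+k) mod p`), one has
`a q + ⌊l a/p⌋ = ⌊(j+k) a/p⌋ = e + ⌊j a/p⌋ + ⌊k a/p⌋` with
`e = ⌊(j+k)a/p⌋ - ⌊j a/p⌋ - ⌊k a/p⌋` (a natural number). [folklore] -/
theorem kummer_floor_identity (p a j k : ℕ) (hp : 0 < p) :
    a * ((j + k) / p) + (j + k) % p * a / p =
      ((j + k) * a / p - j * a / p - k * a / p) + j * a / p + k * a / p := by
  have h1 : (j + k) * a / p = a * ((j + k) / p) + (j + k) % p * a / p := by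
    conv_lhs => rw [← Nat.div_add_mod (j + k) p, add_mul, mul_assoc, Nat.mul_add_div hp]
    ring
  have h2 : j * a / p + k * a / p ≤ (j + k) * a / p := by
    rw [add_mul]
    exact Nat.add_div_le_add_div _ _ _
  omega

/-- The multiplication table of the Kummer order, as an identity in `A`:
`(∏ t^a)^q · d_l = e_{jk} · d_j · d_k` where `d_n = ∏_i t_i^{⌊n a_i/p⌋}`, `j + k = p q + l`.
[folklore] -/
theorem kummer_prod_identity {A : Type} [CommRing A] (p : ℕ) (hp : 0 < p) {m : ℕ}
    (t : Fin (m + 1) → A) (a : Fin (m + 1) → ℕ) (j k : ℕ) :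
    (∏ i, t i ^ a i) ^ ((j + k) / p) * ∏ i, t i ^ ((j + k) % p * a i / p) =
      (∏ i, t i ^ ((j + k) * a i / p - j * a i / p - k * a i / p)) *
        (∏ i, t i ^ (j * a i / p)) * ∏ i, t i ^ (k * a i / p) := by
  rw [← Finset.prod_pow, ← Finset.prod_mul_distrib, ← Finset.prod_mul_distrib,
    ← Finset.prod_mul_distrib]
  refine Finset.prod_congr rfl fun i _ => ?_
  rw [← pow_mul, ← pow_add, ← pow_add, ← pow_add, kummer_floor_identity p (a i) j k hp]

/-- The `p`-th powers of the generators, as an identity in `A`: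
`(∏ t^a)^j = (∏_i t_i^{(j a_i) mod p}) · d_j^p`. [folklore] -/
theorem kummer_pow_identity {A : Type} [CommRing A] (p : ℕ) {m : ℕ}
    (t : Fin (m + 1) → A) (a : Fin (m + 1) → ℕ) (j : ℕ) :
    (∏ i, t i ^ a i) ^ j = (∏ i, t i ^ (j * a i % p)) * (∏ i, t i ^ (j * a i / p)) ^ p := by
  rw [← Finset.prod_pow, ← Finset.prod_pow, ← Finset.prod_mul_distrib]
  refine Finset.prod_congr rfl fun i _ => ?_
  rw [← pow_mul, ← pow_mul, ← pow_add, Nat.mod_add_div' (j * a i) p, mul_comm]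

/-- `A → L` is injective (`A → K = Frac A` is, and `K → L` is a field map). [folklore] -/
theorem algebraMap_injective_of_isFractionRing_tower {A : Type} (K : Type) {L : Type} [CommRing A]
    [Field K] [Algebra A K] [IsFractionRing A K] [Field L] [Algebra K L] [Algebra A L]
    [IsScalarTower A K L] : Function.Injective (algebraMap A L) := by
  rw [IsScalarTower.algebraMap_eq A K L]
  exact (algebraMap K L).injective.comp (IsFractionRing.injective A K)

/-- Multiplication table of the Kummer order in `L`:
`z_j · z_k = (∏ t_i^{e_i}) · z_{(j+k) mod p}`, `e_i = ⌊(j+k)a_i/p⌋ - ⌊j a_i/p⌋ - ⌊k a_i/p⌋`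
(`z_n = y^n / ∏_i t_i^{⌊n a_i/p⌋}`, `y^p = ∏ t_i^{a_i}`, `t_i ≠ 0`). [folklore] -/
theorem kummer_generator_mul {A : Type} (K : Type) {L : Type} [CommRing A]
    [Field K] [Algebra A K] [IsFractionRing A K] [Field L] [Algebra K L] [Algebra A L]
    [IsScalarTower A K L] (p : ℕ) (hp : 0 < p) {m : ℕ} (t : Fin (m + 1) → A)
    (ht : ∀ i, t i ≠ 0) (a : Fin (m + 1) → ℕ) (y : L)
    (hyp : y ^ p = algebraMap A L (∏ i, t i ^ a i)) (j k : ℕ) :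
    y ^ j / algebraMap A L (∏ i, t i ^ (j * a i / p)) *
        (y ^ k / algebraMap A L (∏ i, t i ^ (k * a i / p))) =
      algebraMap A L (∏ i, t i ^ ((j + k) * a i / p - j * a i / p - k * a i / p)) *
        (y ^ ((j + k) % p) / algebraMap A L (∏ i, t i ^ ((j + k) % p * a i / p))) := by
  have hinj : Function.Injective (algebraMap A L) :=
    algebraMap_injective_of_isFractionRing_tower K
  have hD : ∀ f : Fin (m + 1) → ℕ, algebraMap A L (∏ i, t i ^ f i) ≠ 0 := by
    intro f
    rw [map_prod]
    exact Finset.prod_ne_zero_iff.mpr fun i _ => by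
      rw [map_pow]
      exact pow_ne_zero _ ((map_ne_zero_iff _ hinj).mpr (ht i))
  have hy' : y ^ (j + k) =
      (algebraMap A L (∏ i, t i ^ a i)) ^ ((j + k) / p) * y ^ ((j + k) % p) := by
    conv_lhs => rw [← Nat.div_add_mod (j + k) p]
    rw [pow_add, pow_mul, hyp]
  rw [div_mul_div_comm, ← pow_add, mul_div_assoc',
    div_eq_div_iff (mul_ne_zero (hD _) (hD _)) (hD _), hy']
  have key := congrArg (algebraMap A L) (kummer_prod_identity p hp t a j k)
  rw [map_mul, map_mul, map_mul, map_pow] at key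
  linear_combination y ^ ((j + k) % p) * key

/-- `p`-th powers of the generators of the Kummer order lie in `A`:
`z_j^p = ∏ t_i^{(j a_i) mod p}` (`z_j = y^j / ∏_i t_i^{⌊j a_i/p⌋}`, `y^p = ∏ t_i^{a_i}`).
[folklore] -/
theorem kummer_generator_pow {A : Type} (K : Type) {L : Type} [CommRing A]
    [Field K] [Algebra A K] [IsFractionRing A K] [Field L] [Algebra K L] [Algebra A L]
    [IsScalarTower A K L] (p : ℕ) {m : ℕ} (t : Fin (m + 1) → A)
    (ht : ∀ i, t i ≠ 0) (a : Fin (m + 1) → ℕ) (y : L)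
    (hyp : y ^ p = algebraMap A L (∏ i, t i ^ a i)) (j : ℕ) :
    (y ^ j / algebraMap A L (∏ i, t i ^ (j * a i / p))) ^ p =
      algebraMap A L (∏ i, t i ^ (j * a i % p)) := by
  have hinj : Function.Injective (algebraMap A L) :=
    algebraMap_injective_of_isFractionRing_tower K
  have hD : ∀ f : Fin (m + 1) → ℕ, algebraMap A L (∏ i, t i ^ f i) ≠ 0 := by
    intro f
    rw [map_prod]
    exact Finset.prod_ne_zero_iff.mpr fun i _ => by
      rw [map_pow]
      exact pow_ne_zero _ ((map_ne_zero_iff _ hinj).mpr (ht i))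
  rw [div_pow, ← pow_mul, mul_comm j p, pow_mul, hyp, ← map_pow, ← map_pow,
    div_eq_iff (by rw [map_pow]; exact pow_ne_zero _ (hD _)), ← map_mul]
  congr 1
  exact kummer_pow_identity p t a j

/-- If `y ∈ L ∖ K` satisfies `y^p = u ∈ A` (`K` of characteristic `p` prime), then the minimal
polynomial of `y` over `K` is `T^p - u` (irreducible since `u` is not a `p`-th power in `K`,
Frobenius being injective on `L`); in particular `1, y, …, y^{p-1}` are `K`-linearly independent.
[folklore] -/
theorem linearIndependent_pow_of_pth_root {A K L : Type} [CommRing A] [Field K] [Algebra A K]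
    [Field L] [Algebra K L] [Algebra A L] [IsScalarTower A K L] (p : ℕ) (hp : p.Prime) [CharP K p]
    (u : A) (y : L) (hy : y ∉ Set.range (algebraMap K L))
    (hyp : y ^ p = algebraMap A L u) :
    LinearIndependent K fun j : Fin p => y ^ (j : ℕ) := by
  haveI : Fact p.Prime := ⟨hp⟩
  haveI : CharP L p := charP_of_injective_algebraMap (algebraMap K L).injective p
  have hirr : Irreducible ((X : K[X]) ^ p - C (algebraMap A K u)) := by
    refine X_pow_sub_C_irreducible_of_prime hp fun b hb => hy ⟨b, ?_⟩
    have h1 : (algebraMap K L b) ^ p = y ^ p := by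
      rw [← map_pow, hb, hyp, ← IsScalarTower.algebraMap_apply]
    exact frobenius_inj L p h1
  have hroot : aeval y ((X : K[X]) ^ p - C (algebraMap A K u)) = 0 := by
    simp only [map_sub, map_pow, aeval_X, aeval_C, ← IsScalarTower.algebraMap_apply, hyp, sub_self]
  have hmin : minpoly K y = (X : K[X]) ^ p - C (algebraMap A K u) :=
    (minpoly.eq_of_irreducible_of_monic hirr hroot (monic_X_pow_sub_C _ hp.ne_zero)).symm
  have hnat : (minpoly K y).natDegree = p := by
    rw [hmin, natDegree_X_pow_sub_C]
  exact (linearIndependent_pow (K := K) y).comp (Fin.cast hnat.symm) (Fin.cast_injective _)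

/-- **Structure of the Kummer order.** Let `A` be a regular local ring with fraction field `K`
of characteristic `p`, `L/K` of degree `p`, `y ∈ L ∖ K` with `y^p = ∏_{i ≤ m} t_i^{a_i}`, `a₀ = 1`,
`1 ≤ a_i < p`, `t_i ≠ 0`. The `A`-algebra `R ⊆ L` generated by `z_j = y^j / ∏ t_i^{⌊j a_i/p⌋}`
(`j < p`; the family `z` is any family satisfying these equations, hypothesis `hz`) is spanned by
the `z_j` as an `A`-module, freely; it is finite over `A`, local, and `L` is its field of
fractions. [folklore] -/
theorem stub_kummerOrderStructure {A K L : Type} [CommRing A] [IsRegularLocalRing A] [Field K]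
    [Algebra A K] [IsFractionRing A K] [Field L] [Algebra K L] [Algebra A L] [IsScalarTower A K L]
    (p : ℕ) (hp : p.Prime) [CharP K p] (hdeg : Module.finrank K L = p) (m : ℕ)
    (t : Fin (m + 1) → A) (ht : ∀ i, t i ≠ 0) (a : Fin (m + 1) → ℕ) (ha0 : a 0 = 1)
    (ha : ∀ i, 1 ≤ a i ∧ a i < p) (y : L) (hy : y ∉ Set.range (algebraMap K L))
    (hyp : y ^ p = algebraMap A L (∏ i, t i ^ a i)) (z : Fin p → L)
    (hz : ∀ j, z j = y ^ (j : ℕ) / algebraMap A L (∏ i, t i ^ ((j : ℕ) * a i / p))) :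
    Subalgebra.toSubmodule (Algebra.adjoin A (Set.range z)) = Submodule.span A (Set.range z) ∧
    LinearIndependent A z ∧ Module.Finite A (Algebra.adjoin A (Set.range z)) ∧
    IsLocalRing (Algebra.adjoin A (Set.range z)) ∧
    IsFractionRing (Algebra.adjoin A (Set.range z)) L := by
  have _h := ha0
  haveI : Fact p.Prime := ⟨hp⟩
  haveI : CharP L p := charP_of_injective_algebraMap (algebraMap K L).injective p
  haveI : FiniteDimensional K L := Module.finite_of_finrank_pos (by rw [hdeg]; exact hp.pos)
  have hinj : Function.Injective (algebraMap A L) :=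
    algebraMap_injective_of_isFractionRing_tower K
  have hD : ∀ f : Fin (m + 1) → ℕ, algebraMap A L (∏ i, t i ^ f i) ≠ 0 := by
    intro f
    rw [map_prod]
    exact Finset.prod_ne_zero_iff.mpr fun i _ => by
      rw [map_pow]
      exact pow_ne_zero _ ((map_ne_zero_iff _ hinj).mpr (ht i))
  -- (1) the span of the `z_j` is closed under multiplication
  have hzmul : ∀ j k : Fin p, z j * z k ∈ Submodule.span A (Set.range z) := by
    intro j k
    have hmem : z ⟨((j : ℕ) + k) % p, Nat.mod_lt _ hp.pos⟩ ∈ Submodule.span A (Set.range z) :=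
      Submodule.subset_span ⟨_, rfl⟩
    rw [hz] at hmem
    rw [hz, hz, kummer_generator_mul K p hp.pos t ht a y hyp, ← Algebra.smul_def]
    exact Submodule.smul_mem _ _ hmem
  have hz0 : z ⟨0, hp.pos⟩ = 1 := by
    simp [hz]
  have h1 : Subalgebra.toSubmodule (Algebra.adjoin A (Set.range z)) =
      Submodule.span A (Set.range z) := by
    refine Algebra.adjoin_eq_span_of_subset A ?_
    intro x hx
    induction hx using Submonoid.closure_induction with
    | mem x hx => exact Submodule.subset_span hx
    | one => rw [SetLike.mem_coe, ← hz0]; exact Submodule.subset_span ⟨_, rfl⟩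
    | mul u v _ _ hu hv =>
      rw [SetLike.mem_coe] at hu hv ⊢
      have hle : Submodule.span A (Set.range z) * Submodule.span A (Set.range z) ≤
          Submodule.span A (Set.range z) := by
        rw [Submodule.span_mul_span, Submodule.span_le]
        rintro _ ⟨_, ⟨j, rfl⟩, _, ⟨k, rfl⟩, rfl⟩
        exact hzmul j k
      exact hle (Submodule.mul_mem_mul hu hv)
  -- (2) linear independence
  have h2 : LinearIndependent A z := by
    have hliK : LinearIndependent K fun j : Fin p => y ^ (j : ℕ) :=
      linearIndependent_pow_of_pth_root p hp _ y hy hyp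
    have hw0 : ∀ j : Fin p, algebraMap A K (∏ i, t i ^ ((j : ℕ) * a i / p)) ≠ 0 := by
      intro j h0
      apply hD (fun i => (j : ℕ) * a i / p)
      rw [IsScalarTower.algebraMap_apply A K L, h0, map_zero]
    let w : Fin p → Kˣ := fun j => Units.mk0 _ (inv_ne_zero (hw0 j))
    have hliK' : LinearIndependent K z := by
      convert hliK.units_smul w using 1
      ext j
      rw [hz, Pi.smul_apply', Units.smul_def, Algebra.smul_def, div_eq_inv_mul]
      simp only [w, Units.val_mk0, map_inv₀, ← IsScalarTower.algebraMap_apply]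
    exact hliK'.restrict_scalars' A
  -- (3) finiteness
  have h3 : Module.Finite A (Algebra.adjoin A (Set.range z)) := by
    have hfg : (Subalgebra.toSubmodule (Algebra.adjoin A (Set.range z))).FG := by
      rw [h1]
      exact Submodule.fg_span (Set.finite_range z)
    exact Module.Finite.of_fg hfg
  -- (4) locality: `r^p ∈ A` for all `r ∈ R`
  have hpow : ∀ x ∈ Algebra.adjoin A (Set.range z), ∃ c : A, x ^ p = algebraMap A L c := by
    intro x hx
    induction hx using Algebra.adjoin_induction with
    | mem x hx =>
      obtain ⟨j, rfl⟩ := hx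
      refine ⟨∏ i, t i ^ ((j : ℕ) * a i % p), ?_⟩
      rw [hz]
      exact kummer_generator_pow K p t ht a y hyp j
    | algebraMap r => exact ⟨r ^ p, by rw [map_pow]⟩
    | add u v _ _ hu hv =>
      obtain ⟨c, hc⟩ := hu
      obtain ⟨d, hd⟩ := hv
      exact ⟨c + d, by rw [add_pow_char, hc, hd, map_add]⟩
    | mul u v _ _ hu hv =>
      obtain ⟨c, hc⟩ := hu
      obtain ⟨d, hd⟩ := hv
      exact ⟨c * d, by rw [mul_pow, hc, hd, map_mul]⟩
  have h4 : IsLocalRing (Algebra.adjoin A (Set.range z)) := by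
    haveI := h3
    haveI : Algebra.IsIntegral A (Algebra.adjoin A (Set.range z)) := inferInstance
    have key : ∀ I J : Ideal (Algebra.adjoin A (Set.range z)), I.IsMaximal → J.IsMaximal →
        I ≤ J := by
      intro I J hI hJ x hx
      obtain ⟨c, hc⟩ := hpow x.1 x.2
      have hxp : x ^ p = algebraMap A (Algebra.adjoin A (Set.range z)) c :=
        Subtype.ext (by simpa using hc)
      have hcI : c ∈ I.comap (algebraMap A (Algebra.adjoin A (Set.range z))) := by
        rw [Ideal.mem_comap, ← hxp]
        exact I.pow_mem_of_mem hx p hp.pos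
      have hIc : I.comap (algebraMap A (Algebra.adjoin A (Set.range z))) ≤
          IsLocalRing.maximalIdeal A :=
        IsLocalRing.le_maximalIdeal (Ideal.comap_ne_top _ hI.ne_top)
      have hJc : J.comap (algebraMap A (Algebra.adjoin A (Set.range z))) =
          IsLocalRing.maximalIdeal A := by
        haveI := hJ
        exact IsLocalRing.eq_maximalIdeal
          (Ideal.isMaximal_comap_of_isIntegral_of_isMaximal (R := A) J)
      have hcJ : c ∈ J.comap (algebraMap A (Algebra.adjoin A (Set.range z))) :=
        hJc ▸ hIc hcI
      rw [Ideal.mem_comap, ← hxp] at hcJ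
      exact hJ.isPrime.mem_of_pow_mem p hcJ
    obtain ⟨M, hM⟩ := Ideal.exists_maximal (Algebra.adjoin A (Set.range z))
    exact IsLocalRing.of_unique_max_ideal
      ⟨M, hM, fun M' hM' => hM'.eq_of_le hM.ne_top (key M' M hM' hM)⟩
  -- (5) `Frac R = L`
  have h5 : IsFractionRing (Algebra.adjoin A (Set.range z)) L := by
    haveI : FaithfulSMul (Algebra.adjoin A (Set.range z)) L :=
      (faithfulSMul_iff_algebraMap_injective _ L).mpr Subtype.val_injective
    have hyR : y ∈ Algebra.adjoin A (Set.range z) := by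
      have hdiv : ∀ i, a i / p = 0 := fun i => Nat.div_eq_of_lt (ha i).2
      have h1y : z ⟨1, hp.one_lt⟩ = y := by
        simp [hz, hdiv]
      rw [← h1y]
      exact Algebra.subset_adjoin ⟨_, rfl⟩
    refine IsFractionRing.of_field _ L fun x => ?_
    obtain ⟨q, b, -, hx⟩ := exists_aeval_div_eq hp hdeg (∏ i, t i ^ a i) y hy hyp x
    have hq : aeval y q ∈ Algebra.adjoin A (Set.range z) := by
      have hle : Algebra.adjoin A {y} ≤ Algebra.adjoin A (Set.range z) :=
        Algebra.adjoin_le (Set.singleton_subset_iff.mpr hyR)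
      refine hle ?_
      rw [Algebra.adjoin_singleton_eq_range_aeval]
      exact ⟨q, rfl⟩
    exact ⟨⟨aeval y q, hq⟩, ⟨algebraMap A L b, Subalgebra.algebraMap_mem _ b⟩, hx⟩
  exact ⟨h1, h2, h3, h4, h5⟩

end Summit.ResolutionOfSingularities.ResolutionOfSingularities.Theorems.RadicialJung.CleanModelsSuffice

end
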